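import Summits.QuantumFields.QCD.Theses.SpectralDefectExtinction
import Literature.MathematicalPhysics.QuantumFieldTheory.QCDPhaseQuenched
import Literature.MathematicalPhysics.QuantumFieldTheory.SpectralDefectDensity
import Literature.Barriers.QuantumFields.WilsonDeterminantMassSplitting

/-!
# Bridge lemma E toward stub `coareaWegner` of line `Sketch` (skeleton "ResolventCell", gen 2) for
crux `SpectralDefectExtinction.WegnerEstimate` (item stmt-QuantumFields-8966):
the tube sum — small-ball (saturated-tube) bounds give integrability of `bad^{-k}`

Hypothesis (i) of `stub_currentRigidity` ("saturated tubes are small") bounds the product-Haar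
measure of the cell configurations that can be moved into `{bad < δ}` by changing one link by
`C_B δ^m`, `δ ∈ (0, 1]`, with `m > k`, where `k` is the exponent of the rigidity inequality (ii).  The
coarea / level-set weight of the paper proof (Lines/Sketch.md §gen 2) is `bad^{-k}` (or the supremum
of `bad^{-k}` over a one-link fibre), and the only thing the analysis needs from (i) is the resulting
"tube sum" `∫ bad^{-k} ≤ 1 + C_B ∫_1^∞ s^{-m/k} ds = 1 + C_B · k/(m − k) < ∞`.

`coareaWegner_lintegral_rpow_neg_le` is that layer-cake computation in Mathlib vocabulary, for an
arbitrary probability measure `μ`, a measurable `f ≥ 0` and real exponents `0 < k < m`: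
if `μ{f < δ} ≤ C δ^m` for all `δ ∈ (0, 1]` then `∫⁻ (f x)^{-k} dμ ≤ 1 + C · k/(m − k)`
(`lintegral_eq_lintegral_meas_lt`, `{t < f^{-k}} ⊆ {f < t^{-1/k}}` for `t > 1`,
`integral_Ioi_rpow_of_lt`).
-/

noncomputable section

namespace Summit.QuantumFields.QCD.Cruxes.WegnerEstimate.ResolventCell

open MeasureTheory
open scoped Matrix BigOperators ENNReal
open Literature.MathematicalPhysics.QuantumLattice Literature.MathematicalPhysics.QuantumFieldTheory
  Literature.Probability.LatticeModels
open Matrix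
open scoped ComplexOrder

/-- **Tube sum (layer cake).**  On a probability space, if a measurable `f ≥ 0` has small balls
`μ{f < δ} ≤ C δ^m` for all `δ ∈ (0, 1]`, then for every exponent `0 < k < m` the negative moment
is finite: `∫⁻ (f x)^{-k} dμ ≤ 1 + C · k / (m − k)`.  (`∫ f^{-k} = ∫_0^∞ μ{f^{-k} > t} dt`, the part
`t ≤ 1` is at most `1`, and for `t > 1`, `{f^{-k} > t} ⊆ {f < t^{-1/k}}` has measure
`≤ C t^{-m/k}`, integrable since `m/k > 1`.) -/
theorem coareaWegner_lintegral_rpow_neg_le {α : Type*} [MeasurableSpace α] (μ : Measure α)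
    [IsProbabilityMeasure μ] {f : α → ℝ} (hf : Measurable f) (hf0 : ∀ x, 0 ≤ f x) {C m k : ℝ}
    (hC : 0 ≤ C) (hk : 0 < k) (hkm : k < m)
    (hsmall : ∀ δ : ℝ, 0 < δ → δ ≤ 1 → μ {x | f x < δ} ≤ ENNReal.ofReal (C * δ ^ m)) :
    ∫⁻ x, ENNReal.ofReal (f x ^ (-k)) ∂μ ≤ ENNReal.ofReal (1 + C * (k / (m - k))) := by
  have hmeas : AEMeasurable (fun x => f x ^ (-k)) μ := (hf.pow_const (-k)).aemeasurable
  have hnn : 0 ≤ᵐ[μ] fun x => f x ^ (-k) :=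
    Filter.Eventually.of_forall fun x => Real.rpow_nonneg (hf0 x) _
  rw [lintegral_eq_lintegral_meas_lt μ hnn hmeas, ← Set.Ioc_union_Ioi_eq_Ioi zero_le_one,
    lintegral_union measurableSet_Ioi Set.Ioc_disjoint_Ioi_same]
  -- the part `t ≤ 1`
  have h1 : ∫⁻ t in Set.Ioc (0 : ℝ) 1, μ {a | t < f a ^ (-k)} ≤ ENNReal.ofReal 1 := by
    calc ∫⁻ t in Set.Ioc (0 : ℝ) 1, μ {a | t < f a ^ (-k)}
        ≤ ∫⁻ _ in Set.Ioc (0 : ℝ) 1, 1 := setLIntegral_mono' measurableSet_Ioc fun t _ => prob_le_one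
      _ = ENNReal.ofReal 1 := by
        rw [setLIntegral_const, Real.volume_Ioc, sub_zero, one_mul]
  -- the part `t > 1`
  have hk0 : k ≠ 0 := hk.ne'
  have hmk : m - k ≠ 0 := sub_ne_zero.2 hkm.ne'
  have hexp : (-k)⁻¹ * m < -1 := by
    have h1k : 1 < m / k := (one_lt_div hk).2 hkm
    have : (-k)⁻¹ * m = -(m / k) := by
      field_simp
    rw [this]
    linarith
  have h2 : ∫⁻ t in Set.Ioi (1 : ℝ), μ {a | t < f a ^ (-k)} ≤ ENNReal.ofReal (C * (k / (m - k))) := by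
    calc ∫⁻ t in Set.Ioi (1 : ℝ), μ {a | t < f a ^ (-k)}
        ≤ ∫⁻ t in Set.Ioi (1 : ℝ), ENNReal.ofReal (C * t ^ ((-k)⁻¹ * m)) := by
          refine setLIntegral_mono' measurableSet_Ioi fun t ht => ?_
          have ht0 : (0 : ℝ) < t := zero_lt_one.trans ht
          have hsub : {a | t < f a ^ (-k)} ⊆ {a | f a < t ^ (-k)⁻¹} := by
            intro a ha
            simp only [Set.mem_setOf_eq] at ha ⊢
            have hfa : 0 < f a := by
              rcases (hf0 a).eq_or_lt with h | h
              · rw [← h, Real.zero_rpow (neg_ne_zero.2 hk0)] at ha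
                exact absurd (ht0.trans ha) (lt_irrefl _)
              · exact h
            exact (Real.lt_rpow_inv_iff_of_neg hfa ht0 (neg_lt_zero.2 hk)).2 ha
          have hδ0 : 0 < t ^ (-k)⁻¹ := Real.rpow_pos_of_pos ht0 _
          have hδ1 : t ^ (-k)⁻¹ ≤ 1 :=
            Real.rpow_le_one_of_one_le_of_nonpos ht.le (inv_nonpos.2 (neg_nonpos.2 hk.le))
          calc μ {a | t < f a ^ (-k)} ≤ μ {a | f a < t ^ (-k)⁻¹} := measure_mono hsub
            _ ≤ ENNReal.ofReal (C * (t ^ (-k)⁻¹) ^ m) := hsmall _ hδ0 hδ1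
            _ = ENNReal.ofReal (C * t ^ ((-k)⁻¹ * m)) := by rw [Real.rpow_mul ht0.le]
      _ = ENNReal.ofReal (∫ t in Set.Ioi (1 : ℝ), C * t ^ ((-k)⁻¹ * m)) := by
          rw [ofReal_integral_eq_lintegral_ofReal]
          · exact (integrableOn_Ioi_rpow_of_lt hexp zero_lt_one).const_mul C
          · exact (ae_restrict_iff' measurableSet_Ioi).2 (Filter.Eventually.of_forall
              fun t ht => mul_nonneg hC (Real.rpow_nonneg (zero_le_one.trans (le_of_lt ht)) _))
      _ = ENNReal.ofReal (C * (k / (m - k))) := by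
          rw [integral_const_mul, integral_Ioi_rpow_of_lt hexp zero_lt_one, Real.one_rpow]
          congr 2
          have : (-k)⁻¹ * m + 1 = (k - m) / k := by
            field_simp
            ring
          rw [this]
          have hkm' : k - m ≠ 0 := sub_ne_zero.2 hkm.ne
          field_simp
          ring
  calc (∫⁻ t in Set.Ioc (0 : ℝ) 1, μ {a | t < f a ^ (-k)}) + ∫⁻ t in Set.Ioi (1 : ℝ), μ {a | t < f a ^ (-k)}
      ≤ ENNReal.ofReal 1 + ENNReal.ofReal (C * (k / (m - k))) := add_le_add h1 h2
    _ = ENNReal.ofReal (1 + C * (k / (m - k))) := by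
        rw [← ENNReal.ofReal_add zero_le_one (mul_nonneg hC (div_nonneg hk.le (sub_nonneg.2 hkm.le)))]

end Summit.QuantumFields.QCD.Cruxes.WegnerEstimate.ResolventCell

end
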